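import Summits.QuantumFields.BalabanUV.Beta.GAN24.TransportIrrelevant

/-!
# `BalabanUV.Beta.GAN24.TransportIrrelevantSym` — binder row G-an2-4 / (CONV-C), W-slot road «W3», **ROW W3-F3b (T-irr) UNDER THE
# BOND-SYMMETRISED ZERO-MODE HYPOTHESIS** (gan24-p1-g5 `SKELETON-W3.md` v1.0.2 §8.3 ∕ §8.6; ref2 r57 R57-2: `Zfree` of record = «jointly `Lc`-covariant ∧
# `zmode Lc X κ κ′ (inl κ₁) (inl κ₂) = 0`»): **the `k`-fold transport already contracts, one factor `Lc⁻¹` per composite-push step, when only the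
# BOND-SYMMETRISED field–field charge `zmode Lc X κ κ′ ff + zmode Lc X κ′ κ ff` vanishes** — `LocStencil₂ (transport A m k X) (CT″·C·(Lc⁻¹)^k) δT` at `d = 3`

NOT IN PRINT; OUR PROOF ([folklore] bookkeeping over the landed row `TransportIrrelevant.transport_irrelevant` p213474).  WHY THIS MODULE.  The literal
first step of the normalised `T₂`-recursion SYMMETRISES the bond pair (leaf-04's `vsym = ½(V + V_swap)`), so its output's period-1 charge is
`zmode 1 (A_j X) μ ν ff = (−c∕2)·(−Lc^{−4(d+2)})·(zmode Lc X μ ν ff + zmode Lc X ν μ ff)` (`zmode_one_step_eq`, = the two halves of leaf-12 gen 20's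
`LinStepCharge.zmode_one_step_eq_zero` kept as an identity; leaf-18-g17's count l.9613 (1) in the period currency): a bond-ANTISYMMETRIC charge of the
input is KILLED by the first step.  Since the (T-irr) chain of p213474 is «one general step, then ONE composite four-leg push of the (period-1 covariant,
charge-free) output», the row needs ONLY the symmetrised charge of `X` to vanish.  We derive it WITHOUT re-running the chain: after the first step the
output `A_m X` is `1`-covariant (`LinStepCharge.step_translate`), hence `Lc`-covariant, ff-charge-free at period `1` (`zmode_one_step_eq_zero_of_symZ`) hence
at period `Lc` (`zmode_eq_pow_mul_zmode_one`), and a `LocStencil₂` family at the rate `min mK δin ∕ 128` (`TransportMarginal.step_shape`) — so the LANDED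
row applies to it from level `m+1` (`AffineUnroll.transport_succ'`); the extra first step costs the factor `Lc·|c|·cSand` in `CT″` ((R12-2): constants
may depend on `Lc`; the pin bounds `|c|`).
CONSEQUENCE FOR THE ROW TABLE (owner's ∕ ref2's call; the ENDs stay byte-identical — `Zfree` is a PARAMETER): with
`ZfreeSym X := (jointly Lc-covariant) ∧ (∀ κ κ′ κ₁ κ₂, zmode Lc X κ κ′ (inl κ₁) (inl κ₂) + zmode Lc X κ′ κ (inl κ₁) (inl κ₂) = 0)` — implied by the `Zfree`
of record (`zfreeSym_of_zfree`) — ROW W3-F3b holds verbatim (`hTirr_three_symZ_slot`), rows F2a∕F2b∕F4d owe only SYMMETRISED charges, and leaf-18-g17's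
located obstruction l.9613 (4) on ROW W3-F4d (`Asym Z(D₀) = −Asym Z₀ ≠ 0` at `Tc := w22 N`) does not arise: `Sym Z(D₀) = (λ₀ − 1)·Sym Z₀` given F2a, i.e.
`hZ0` ⟺ the exact pin, as designed ((N-F4d)).  Nothing here asserts which `Zfree` the owner adopts.
HONEST FRAMING (cell contract, verbatim): «discharging `BetaPertH` makes Bałaban's UV stability UNCONDITIONAL — a real constructive-QFT result; it is NOT the
continuum limit and NOT the Clay problem.»  HONEST DEPENDENCY (verbatim): «continuum YM on T⁴ ⇐ BetaPertH ∧ nine spine estimates (0/9 proved); BetaPertH ⇐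
(D1) ∧ (D4) ∧ CAP+tail; G-an2-4 gates asym, D1 and NE2/3/4.»  THIS IS ROW W3-F3b ONLY (a weaker-hypothesis form of p213474); NOTHING of «T2Shape» ∕
«T2SupRate» ∕ (hW₂, hW₂all) is discharged; the pin is an hypothesis; NOT «W-slot closed», NEVER «G-an2-4 closed»; NOT `BetaPertH`, NOT continuum, NOT Clay.
0 cited facts, 0 `def`, 0 `def … : Prop`, 0 wall binders, 0 sorry.

## What is proved
* §1 (generic `d`) `zmode_one_step_eq` — the period-1 ff charge of the first step's output is `(−(c∕2))·(−(Lc^{d+2})⁻⁴)·(Z_X(μ,ν) + Z_X(ν,μ))`;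
  `zmode_one_step_eq_zero_of_symZ`.
* §2 (generic `d`) `translate_zsmul_of_translate_one` (1-covariant ⇒ `N`-covariant), `zmode_eq_pow_mul_zmode_one` (`zmode N Y = N^{d+1}·zmode 1 Y` for a
  1-covariant `Y`), `zfreeSym_of_zfree` (the record `Zfree` implies `ZfreeSym`).
* §3 (`d = 3`) **`transport_irrelevant_symZ`**, `transport_irrelevant_symZ_pin`, `hTirr_three_symZ`, **`hTirr_three_symZ_slot`** — the END's `hTirr` binder
  (`WSlotT2OfPieces.shape_of_rows` ∕ `rate_of_rows` ∕ `t2Shape_of_rows` ∕ `t2Drift_of_rows`) at the §8.3 transport of record with `ZfreeSym` inline, any `mom`,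
  `ρ := Lc⁻¹`, ∀-input-rate form ((w8)∕(w10)); a closing `example` re-derives p213474's slot type from it (consistency by name).
Unit `b2b-balaban-gan24-formalise-leaf-12` (G-an2-4 formalisation swarm, leaf prover 12, gen 21; ROW W3-F3b holder), 2026-08-20.
-/

noncomputable section

open Finset
open scoped BigOperators
open Literature.MathematicalPhysics.QuantumFieldTheory
open Literature.MathematicalPhysics.QuantumFieldTheory.Balaban1983to89
open Literature.MathematicalPhysics.QuantumFieldTheory.Balaban1983to89.Beta
open ExpKernelCalculus (MKer Decays comp Zl Zl_pos Zl_nonneg shiftK)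
open OneStepResolventKernel (Fib)
open OneStepKernelFamily (colH KInvStep shiftK_KInvStep)
open Summit.QuantumFields.BalabanUV.Beta.HessKerDressedUnits (unitK)
open BalabanCompositeJets (LocStencil₂ LocStencil₂.nonneg)
open BalabanStepJetsSucc (mmRead)
open SecondOrderResponse (vertex2OfK cBi cBi_nonneg)
open AffineAveraging (box toSite)
open Summit.QuantumFields.BalabanUV.Beta.GAN24.CombesThomas (KStepUnit UnitDecayK sfStep smStep)
open Summit.QuantumFields.BalabanUV.Beta.GAN24.T2RecursionAffine (lin4)
open Summit.QuantumFields.BalabanUV.Beta.GAN24.Push4Iter (BiTab locStencil₂_swapT)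
open Summit.QuantumFields.BalabanUV.Beta.GAN24.AffineUnroll (transport transport_zero transport_succ')
open Summit.QuantumFields.BalabanUV.Beta.GAN24.Push4Slices (abs_tsum_z_le abs_tsum_xz_le abs_sliceSum_le)
open Summit.QuantumFields.BalabanUV.Beta.GAN24.BiStencilZeroMode (Tab zmode zmode_one)
open Summit.QuantumFields.BalabanUV.Beta.GAN24.LinT2ZeroMode (linT2 linT2_translate zmode_one_swap)
open Summit.QuantumFields.BalabanUV.Beta.GAN24.LinT2ZeroModeStep (shiftK_unitK zmode_one_linT2_unitKInvStep_step')
open Summit.QuantumFields.BalabanUV.Beta.GAN24.TransversalZeroMode (inner_add_eq inner_smul zmode_eq_pow_mul_inner)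
open Summit.QuantumFields.BalabanUV.Beta.GAN24.LinStepCharge (locStencil₂_linT2 step_eq_lin step_translate)
open Summit.QuantumFields.BalabanUV.Beta.GAN24.TransportMarginal (step_shape locStencil₂_weaken)
open Summit.QuantumFields.BalabanUV.Beta.GAN24.LinSandwichShape (cSand_nonneg)
open Summit.QuantumFields.BalabanUV.Beta.GAN24.TransportIrrelevant (transport_irrelevant)

namespace Summit.QuantumFields.BalabanUV.Beta.GAN24.TransportIrrelevantSym

variable {d : ℕ}

/-! ## §1 The first step symmetrises the bond pair of the charge (generic `d`) -/

section Step

variable {Lc : ℕ} [NeZero Lc] {CK mK c : ℝ} {A : ℕ → BiTab d → BiTab d}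
  (hK : ∀ j, Decays (KStepUnit (d := d) Lc j) CK mK) (hmK : 0 < mK)
  (hA : ∀ j X κ u κ' u', A j X κ u κ' u' = -(c • mmRead Lc (comp (comp (KStepUnit (d := d) Lc j)
    ((1 / 2 : ℝ) • (vertex2OfK (KStepUnit (d := d) Lc j) Lc X κ u κ' u' + vertex2OfK (KStepUnit (d := d) Lc j) Lc X κ' u' κ u)))
    (KStepUnit (d := d) Lc j))))

include hK hmK hA in
/-- [folklore] **THE PERIOD-1 FIELD–FIELD CHARGE OF THE FIRST STEP'S OUTPUT** (leaf-12 gen 20's `LinStepCharge.zmode_one_step_eq_zero` kept as an IDENTITY;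
leaf-18-g17's count l.9613 (1) in the period currency): for a jointly `Lc`-covariant `LocStencil₂` table `X`,
`zmode 1 (A j X) μ ν (inl α) (inl β) = (−(c∕2)) · (−(Lc^{d+2})⁻⁴) · (zmode Lc X μ ν (inl α) (inl β) + zmode Lc X ν μ (inl α) (inl β))` — the direct half by
leaf-02's `zmode_one_linT2_unitKInvStep_step'`, the swapped half by `zmode_one_swap` (covariance), the linearity of the inner sums by leaf-16's `inner_add_eq` ∕
`inner_smul` with the nested summabilities of `Push4Slices`.  The linear step acts on the charge tensor by `λ·Sym_{μν}`, NOT by a scalar. -/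
theorem zmode_one_step_eq (j : ℕ) {X : BiTab d} {C δ : ℝ} (hX : LocStencil₂ X C δ) (hδ : 0 < δ)
    (hXcov : ∀ κ u κ' u' t, X κ (u + (Lc : ℤ) • t) κ' (u' + (Lc : ℤ) • t) = shiftK (-((Lc : ℤ) • t)) (X κ u κ' u')) (μ ν α β : Fin (d + 1)) :
    zmode 1 (A j X) μ ν (Sum.inl α) (Sum.inl β)
      = (-(c / 2)) * (-(((Lc : ℝ) ^ (d + 1 + 1))⁻¹) ^ 4) *
          (zmode Lc X μ ν (Sum.inl α) (Sum.inl β) + zmode Lc X ν μ (Sum.inl α) (Sum.inl β)) := by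
  have hCK : 0 ≤ CK := (hK 0).nonneg (Sum.inl 0)
  have hLc : 1 ≤ Lc := Nat.one_le_iff_ne_zero.2 (NeZero.ne Lc)
  -- the two halves as `LocStencil₂` families (for the summabilities of their inner sums)
  set δ₀ : ℝ := min δ (mK / 4) with hδ₀
  have hδ₀p : 0 < δ₀ := lt_min hδ (by positivity)
  have h3 : 3 * δ₀ < mK := by have := min_le_right δ (mK / 4); linarith
  have hX₀ : LocStencil₂ X C δ₀ := hX.mono (min_le_left _ _)
  have hF₁ := locStencil₂_linT2 (hK j) hCK hLc hX₀ hδ₀p h3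
  have hF₂ := locStencil₂_swapT hF₁ (by positivity)
  set F₁ : BiTab d := linT2 (KStepUnit (d := d) Lc j) Lc X with hF₁_def
  set F₂ : BiTab d := fun κ u κ' u' => linT2 (KStepUnit (d := d) Lc j) Lc X κ' u' κ u with hF₂_def
  have hδ4 : 0 < δ₀ / 4 := by positivity
  have hδ12 : 0 < δ₀ / 4 / 3 := by positivity
  -- the charges of the two halves
  have hKcov : ∀ t, shiftK (-((Lc : ℤ) • t)) (KStepUnit (d := d) Lc j) = KStepUnit (d := d) Lc j := fun t => by
    rw [KStepUnit, shiftK_unitK, shiftK_KInvStep]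
  have hz₁ : zmode 1 F₁ μ ν (Sum.inl α) (Sum.inl β) = -(((Lc : ℝ) ^ (d + 1 + 1))⁻¹) ^ 4 * zmode Lc X μ ν (Sum.inl α) (Sum.inl β) := by
    rw [hF₁_def, KStepUnit, zmode_one_linT2_unitKInvStep_step' j hX hδ hXcov μ ν α β]
  have hz₂ : zmode 1 F₂ μ ν (Sum.inl α) (Sum.inl β) = -(((Lc : ℝ) ^ (d + 1 + 1))⁻¹) ^ 4 * zmode Lc X ν μ (Sum.inl α) (Sum.inl β) := by
    have hcov₁ : ∀ μ y ν y' t, F₁ μ (y + t) ν (y' + t) = shiftK (-t) (F₁ μ y ν y') :=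
      fun μ y ν y' t => linT2_translate hKcov hXcov μ y ν y' t
    rw [hF₂_def, zmode_one_swap F₁ hcov₁, hF₁_def, KStepUnit, zmode_one_linT2_unitKInvStep_step' j hX hδ hXcov ν μ α β]
  -- linearity of the inner sums at the base bond `0`
  rw [step_eq_lin hK hmK hA j hX hδ, zmode_one, inner_smul]
  have hadd := inner_add_eq (X := F₁) (Y := F₂) μ 0 ν (Sum.inl α) (Sum.inl β)
    (fun u' x => (abs_tsum_z_le hF₁ hδ4 μ 0 ν u' x _ _).1) (fun u' x => (abs_tsum_z_le hF₂ hδ12 μ 0 ν u' x _ _).1)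
    (fun u' => (abs_tsum_xz_le hF₁ hδ4 μ 0 ν u' _ _).1) (fun u' => (abs_tsum_xz_le hF₂ hδ12 μ 0 ν u' _ _).1)
    (abs_sliceSum_le hF₁ hδ4 μ 0 ν α β).1 (abs_sliceSum_le hF₂ hδ12 μ 0 ν α β).1
  rw [hadd]
  rw [zmode_one] at hz₁ hz₂
  rw [hz₁, hz₂]
  ring

include hK hmK hA in
/-- [folklore] **A BOND-ANTISYMMETRIC CHARGE IS KILLED BY THE FIRST STEP**: if `zmode Lc X κ κ′ ff + zmode Lc X κ′ κ ff = 0` for all directions and ff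
slots (only the bond-SYMMETRISED charge of the jointly covariant table `X` is asked to vanish), then `zmode 1 (A j X) μ ν (inl α) (inl β) = 0`. -/
theorem zmode_one_step_eq_zero_of_symZ (j : ℕ) {X : BiTab d} {C δ : ℝ} (hX : LocStencil₂ X C δ) (hδ : 0 < δ)
    (hXcov : ∀ κ u κ' u' t, X κ (u + (Lc : ℤ) • t) κ' (u' + (Lc : ℤ) • t) = shiftK (-((Lc : ℤ) • t)) (X κ u κ' u'))
    (hsym : ∀ κ κ' κ₁ κ₂, zmode Lc X κ κ' (Sum.inl κ₁) (Sum.inl κ₂) + zmode Lc X κ' κ (Sum.inl κ₁) (Sum.inl κ₂) = 0) (μ ν α β : Fin (d + 1)) :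
    zmode 1 (A j X) μ ν (Sum.inl α) (Sum.inl β) = 0 := by
  rw [zmode_one_step_eq hK hmK hA j hX hδ hXcov, hsym, mul_zero]

end Step

/-! ## §2 From period `1` to period `N`; the record `Zfree` implies the symmetrised one (generic `d`) -/

/-- [folklore] A table covariant under ALL unit translations is jointly `N`-covariant for every blocking `N`. -/
theorem translate_zsmul_of_translate_one {Y : BiTab d}
    (hY : ∀ (κ : Fin (d + 1)) (u : Fin (d + 1) → ℤ) (κ' : Fin (d + 1)) (u' t : Fin (d + 1) → ℤ), Y κ (u + t) κ' (u' + t) = shiftK (-t) (Y κ u κ' u'))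
    (N : ℕ) (κ : Fin (d + 1)) (u : Fin (d + 1) → ℤ) (κ' : Fin (d + 1)) (u' t : Fin (d + 1) → ℤ) :
    Y κ (u + (N : ℤ) • t) κ' (u' + (N : ℤ) • t) = shiftK (-((N : ℤ) • t)) (Y κ u κ' u') :=
  hY κ u κ' u' ((N : ℤ) • t)

/-- [folklore] For a 1-covariant table the period-`N` charge is `N^{d+1}` times the period-1 charge (leaf-16's `zmode_eq_pow_mul_inner` and leaf-02's `zmode_one`). -/
theorem zmode_eq_pow_mul_zmode_one {Y : BiTab d}
    (hY : ∀ (κ : Fin (d + 1)) (u : Fin (d + 1) → ℤ) (κ' : Fin (d + 1)) (u' t : Fin (d + 1) → ℤ), Y κ (u + t) κ' (u' + t) = shiftK (-t) (Y κ u κ' u'))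
    (N : ℕ) (κ κ' : Fin (d + 1)) (a b : Fib d) :
    zmode N Y κ κ' a b = ((N : ℝ)) ^ (d + 1) * zmode 1 Y κ κ' a b := by
  rw [zmode_eq_pow_mul_inner hY, zmode_one]

/-- [folklore] **THE `Zfree` OF RECORD IMPLIES THE SYMMETRISED ONE** (ref2 r57: `Zfree X := jointly Lc-covariant ∧ zmode Lc X κ κ′ ff = 0`): trivially, term
by term.  Hence every row proved FROM `ZfreeSym` (this module's `hTirr`) implies the same row from the record `Zfree`, and every row proving the record `Zfree`
OF a table (F2a∕F2b∕F4d holders) proves `ZfreeSym` of it. -/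
theorem zfreeSym_of_zfree {Lc : ℕ} {X : BiTab d}
    (h : (∀ κ u κ' u' t, X κ (u + (Lc : ℤ) • t) κ' (u' + (Lc : ℤ) • t) = shiftK (-((Lc : ℤ) • t)) (X κ u κ' u')) ∧
      (∀ κ κ' κ₁ κ₂, zmode Lc X κ κ' (Sum.inl κ₁) (Sum.inl κ₂) = 0)) :
    (∀ κ u κ' u' t, X κ (u + (Lc : ℤ) • t) κ' (u' + (Lc : ℤ) • t) = shiftK (-((Lc : ℤ) • t)) (X κ u κ' u')) ∧
      (∀ κ κ' κ₁ κ₂, zmode Lc X κ κ' (Sum.inl κ₁) (Sum.inl κ₂) + zmode Lc X κ' κ (Sum.inl κ₁) (Sum.inl κ₂) = 0) :=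
  ⟨h.1, fun κ κ' κ₁ κ₂ => by rw [h.2, h.2, add_zero]⟩

/-! ## §3 ROW W3-F3b under the bond-symmetrised zero-mode hypothesis (`d = 3`) -/

section Three

variable {Lc : ℕ} [NeZero Lc] {CK mK : ℝ} {c : ℝ} {A : ℕ → BiTab 3 → BiTab 3}

/-- **ROW W3-F3b (T-irr) UNDER THE BOND-SYMMETRISED ZERO-MODE HYPOTHESIS** (NOT IN PRINT — our proof).  At `d = 3`, for every blocking `Lc ≥ 1`, the K-slot's
uniform decay `UnitDecayK 3 Lc (sfStep Lc) (smStep 3 Lc) CK mK` (`mK > 0`), a scalar with `|c| ≤ Lc^16` and the literal one-step maps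
`A j X = −(c • mmRead Lc (K̃_j ∘ ½(vertex2OfK K̃_j Lc X κuκ′u′ + vertex2OfK K̃_j Lc X κ′u′κu) ∘ K̃_j))`: there are `CT″ ≥ 0` and `0 < δT ≤ δin` with, FOR ALL `m k` and
ALL tables that are `LocStencil₂ X C δin`, JOINTLY `Lc`-COVARIANT and have VANISHING BOND-SYMMETRISED FIELD–FIELD CHARGE
`zmode Lc X κ κ′ (inl κ₁) (inl κ₂) + zmode Lc X κ′ κ (inl κ₁) (inl κ₂) = 0`, `LocStencil₂ (transport A m k X) (CT″·C·(Lc⁻¹)^k) δT`.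
PROOF: `k = 0` identity; for `k + 1` steps the first step's output `A_m X` is a `LocStencil₂` family at rate `min mK δin∕128` (`step_shape`), `1`-covariant
(`step_translate`) hence `Lc`-covariant, and has vanishing ff charge at period `1` (`zmode_one_step_eq_zero_of_symZ`) hence at period `Lc`
(`zmode_eq_pow_mul_zmode_one`); the LANDED row `TransportIrrelevant.transport_irrelevant` (p213474), instantiated at the input rate `min mK δin∕128`, transports it
from level `m + 1` (`transport_succ'`); `CT″ = max 1 (CT′·|c|·cSand·Lc)` absorbs the first step and the one missing factor `Lc⁻¹`. -/
theorem transport_irrelevant_symZ (hLc : 1 ≤ Lc) (hK : UnitDecayK 3 Lc (sfStep Lc) (smStep 3 Lc) CK mK) (hmK : 0 < mK)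
    (hA : ∀ j X κ u κ' u', A j X κ u κ' u' = -(c • mmRead Lc (comp (comp (KStepUnit (d := 3) Lc j)
      ((1 / 2 : ℝ) • (vertex2OfK (KStepUnit (d := 3) Lc j) Lc X κ u κ' u' + vertex2OfK (KStepUnit (d := 3) Lc j) Lc X κ' u' κ u)))
      (KStepUnit (d := 3) Lc j))))
    {δin : ℝ} (hδin : 0 < δin) :
    ∃ CT δT : ℝ, 0 ≤ CT ∧ 0 < δT ∧ δT ≤ δin ∧ (|c| ≤ (Lc : ℝ) ^ 16 → ∀ (m k : ℕ) (X : BiTab 3) (C : ℝ), 0 ≤ C → LocStencil₂ X C δin →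
      (∀ κ u κ' u' t, X κ (u + (Lc : ℤ) • t) κ' (u' + (Lc : ℤ) • t) = shiftK (-((Lc : ℤ) • t)) (X κ u κ' u')) →
      (∀ κ κ' κ₁ κ₂, zmode Lc X κ κ' (Sum.inl κ₁) (Sum.inl κ₂) + zmode Lc X κ' κ (Sum.inl κ₁) (Sum.inl κ₂) = 0) →
      LocStencil₂ (transport A m k X) (CT * C * ((Lc : ℝ)⁻¹) ^ k) δT) := by
  have hK' : ∀ j, Decays (KStepUnit (d := 3) Lc j) CK mK := hK
  have hCK : 0 ≤ CK := (hK' 0).nonneg (Sum.inl 0)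
  have hLc0 : (0 : ℝ) < (Lc : ℝ) := by exact_mod_cast hLc
  have hm₀ : 0 < min mK δin := lt_min hmK hδin
  -- the table rate after the first step, and the landed row at that input rate
  have hδY : 0 < min mK δin / 128 := by positivity
  obtain ⟨CT₁, δT₁, hCT₁, hδT₁, hδT₁Y, h₁⟩ := transport_irrelevant (A := A) hLc hK hmK hA hδY
  -- the first step's constant (`TransportMarginal.step_shape`)
  set cS : ℝ := (Fintype.card (Fib 3) : ℝ) * ((Fintype.card (Fib 3) : ℝ) * (CK * cBi 3 CK 1 (min mK δin)) *
      Zl (3 + 1) (min mK δin / 32 / 2) * CK) * Zl (3 + 1) (min mK δin / 32 / 4) with hcS_def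
  have hcS : 0 ≤ cS := by rw [hcS_def]; exact cSand_nonneg (d := 3) hCK hm₀
  refine ⟨max 1 (CT₁ * |c| * cS * (Lc : ℝ)), δT₁, by positivity, hδT₁, ?_, fun hc m k X C hC hX hXcov hsym => ?_⟩
  · exact hδT₁Y.trans ((div_le_self hm₀.le (by norm_num)).trans (min_le_right _ _))
  have hδT₁in : δT₁ ≤ δin := hδT₁Y.trans ((div_le_self hm₀.le (by norm_num)).trans (min_le_right _ _))
  cases k with
  | zero =>
    rw [transport_zero, pow_zero, mul_one]
    refine locStencil₂_weaken hX ?_ hδT₁in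
    have h1 : (1 : ℝ) ≤ max 1 (CT₁ * |c| * cS * (Lc : ℝ)) := le_max_left _ _
    nlinarith
  | succ k' =>
    rw [transport_succ']
    -- the first step's output: shape, covariance (period 1 ⇒ period Lc), vanishing charge (period 1 ⇒ period Lc)
    have hY := step_shape hLc hK' hmK hA m hX hδin
    have hYcov1 : ∀ κ u κ' u' t, A m X κ (u + t) κ' (u' + t) = shiftK (-t) (A m X κ u κ' u') :=
      fun κ u κ' u' t => step_translate hK' hmK hA m hX hδin hXcov κ u κ' u' t
    have hYcov : ∀ κ u κ' u' t, A m X κ (u + (Lc : ℤ) • t) κ' (u' + (Lc : ℤ) • t) = shiftK (-((Lc : ℤ) • t)) (A m X κ u κ' u') :=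
      translate_zsmul_of_translate_one hYcov1 Lc
    have hYZ : ∀ κ κ' κ₁ κ₂, zmode Lc (A m X) κ κ' (Sum.inl κ₁) (Sum.inl κ₂) = 0 := fun κ κ' κ₁ κ₂ => by
      rw [zmode_eq_pow_mul_zmode_one hYcov1, zmode_one_step_eq_zero_of_symZ hK' hmK hA m hX hδin hXcov hsym, mul_zero]
    have h := h₁ hc (m + 1) k' (A m X) (|c| * (cS * C)) (by positivity) hY hYcov hYZ
    refine locStencil₂_weaken h ?_ le_rfl
    -- `CT₁·(|c|·cS·C)·ρ^k' ≤ max 1 (CT₁·|c|·cS·Lc)·C·ρ^(k'+1)`, `ρ = Lc⁻¹`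
    have eρ : ((Lc : ℝ)⁻¹) ^ (k' + 1) = ((Lc : ℝ)⁻¹) ^ k' * (Lc : ℝ)⁻¹ := pow_succ _ _
    have hρ0 : (0 : ℝ) ≤ ((Lc : ℝ)⁻¹) ^ k' := by positivity
    calc CT₁ * (|c| * (cS * C)) * ((Lc : ℝ)⁻¹) ^ k'
        = (CT₁ * |c| * cS * (Lc : ℝ)) * C * (((Lc : ℝ)⁻¹) ^ k' * (Lc : ℝ)⁻¹) := by field_simp
      _ ≤ max 1 (CT₁ * |c| * cS * (Lc : ℝ)) * C * (((Lc : ℝ)⁻¹) ^ k' * (Lc : ℝ)⁻¹) :=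
          mul_le_mul_of_nonneg_right (mul_le_mul_of_nonneg_right (le_max_right _ _) hC) (by positivity)
      _ = max 1 (CT₁ * |c| * cS * (Lc : ℝ)) * C * ((Lc : ℝ)⁻¹) ^ (k' + 1) := by rw [eρ]

/-- **ROW W3-F3b (symmetrised hypothesis) IN THE PIN's OWN CURRENCY**: for the scalar of record `c = cE₂·Lc^{2(3+1)}` the hypothesis `|c| ≤ Lc^16` IS the pin
`|cE₂| ≤ Lc^{2(3+1)}`. -/
theorem transport_irrelevant_symZ_pin (hLc : 1 ≤ Lc) (hK : UnitDecayK 3 Lc (sfStep Lc) (smStep 3 Lc) CK mK) (hmK : 0 < mK) (cE₂ : ℝ)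
    (hA : ∀ j X κ u κ' u', A j X κ u κ' u' = -((cE₂ * (Lc : ℝ) ^ (2 * (3 + 1))) • mmRead Lc (comp (comp (KStepUnit (d := 3) Lc j)
      ((1 / 2 : ℝ) • (vertex2OfK (KStepUnit (d := 3) Lc j) Lc X κ u κ' u' + vertex2OfK (KStepUnit (d := 3) Lc j) Lc X κ' u' κ u)))
      (KStepUnit (d := 3) Lc j))))
    {δin : ℝ} (hδin : 0 < δin) :
    ∃ CT δT : ℝ, 0 ≤ CT ∧ 0 < δT ∧ δT ≤ δin ∧ (|cE₂| ≤ (Lc : ℝ) ^ (2 * (3 + 1)) →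
      ∀ (m k : ℕ) (X : BiTab 3) (C : ℝ), 0 ≤ C → LocStencil₂ X C δin →
      (∀ κ u κ' u' t, X κ (u + (Lc : ℤ) • t) κ' (u' + (Lc : ℤ) • t) = shiftK (-((Lc : ℤ) • t)) (X κ u κ' u')) →
      (∀ κ κ' κ₁ κ₂, zmode Lc X κ κ' (Sum.inl κ₁) (Sum.inl κ₂) + zmode Lc X κ' κ (Sum.inl κ₁) (Sum.inl κ₂) = 0) →
      LocStencil₂ (transport A m k X) (CT * C * ((Lc : ℝ)⁻¹) ^ k) δT) := by
  obtain ⟨CT, δT, hCT, hδT, hδTin, h⟩ := transport_irrelevant_symZ (c := cE₂ * (Lc : ℝ) ^ (2 * (3 + 1))) hLc hK hmK hA hδin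
  refine ⟨CT, δT, hCT, hδT, hδTin, fun hpin => h ?_⟩
  have hL : (0 : ℝ) ≤ (Lc : ℝ) ^ (2 * (3 + 1)) := by positivity
  rw [abs_mul, abs_of_nonneg hL]
  calc |cE₂| * (Lc : ℝ) ^ (2 * (3 + 1)) ≤ (Lc : ℝ) ^ (2 * (3 + 1)) * (Lc : ℝ) ^ (2 * (3 + 1)) :=
        mul_le_mul_of_nonneg_right hpin hL
    _ = (Lc : ℝ) ^ 16 := by rw [← pow_add]

/-- **ROW W3-F3b (symmetrised hypothesis), LITERAL TRANSPORT OF RECORD** — `P m k := AffineUnroll.transport (fun j ↦ T2RecursionAffine.lin4 (cE₂·Lc^{2(3+1)})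
(unitK (sfStep Lc j) (smStep 3 Lc j) (KInvStep Lc j)) Lc) m k` (SKELETON-W3 v1.0.2 §8.3), constants first, the pin VERBATIM: `transport_irrelevant_symZ_pin` with
`hA := rfl`.  Inputs: `1 ≤ Lc`, the K-slot `UnitDecayK 3 Lc (sfStep Lc) (smStep 3 Lc) CK mK` (`mK > 0`), `δin > 0`. -/
theorem hTirr_three_symZ (hLc : 1 ≤ Lc) (hK : UnitDecayK 3 Lc (sfStep Lc) (smStep 3 Lc) CK mK) (hmK : 0 < mK) (cE₂ : ℝ) {δin : ℝ}
    (hδin : 0 < δin) :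
    ∃ CT δT : ℝ, 0 ≤ CT ∧ 0 < δT ∧ δT ≤ δin ∧ (|cE₂| ≤ (Lc : ℝ) ^ (2 * (3 + 1)) →
      ∀ (m k : ℕ) (X : BiTab 3) (C : ℝ), 0 ≤ C → LocStencil₂ X C δin →
        (∀ κ u κ' u' t, X κ (u + (Lc : ℤ) • t) κ' (u' + (Lc : ℤ) • t) = shiftK (-((Lc : ℤ) • t)) (X κ u κ' u')) →
        (∀ κ κ' κ₁ κ₂, zmode Lc X κ κ' (Sum.inl κ₁) (Sum.inl κ₂) + zmode Lc X κ' κ (Sum.inl κ₁) (Sum.inl κ₂) = 0) →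
        LocStencil₂ (transport (fun j => lin4 (cE₂ * (Lc : ℝ) ^ (2 * (3 + 1)))
          (unitK (sfStep Lc j) (smStep 3 Lc j) (KInvStep (d := 3) Lc j)) Lc) m k X) (CT * C * ((Lc : ℝ)⁻¹) ^ k) δT) :=
  transport_irrelevant_symZ_pin (A := fun j => lin4 (cE₂ * (Lc : ℝ) ^ (2 * (3 + 1))) (unitK (sfStep Lc j) (smStep 3 Lc j) (KInvStep (d := 3) Lc j)) Lc)
    hLc hK hmK cE₂ (fun _ _ _ _ _ _ => rfl) hδin

/-- **ROW W3-F3b IN THE END's SLOT SHAPE UNDER `ZfreeSym`** (`hTirr` of `WSlotT2OfPieces.shape_of_rows` ∕ `rate_of_rows` ∕ `t2Shape_of_rows` ∕ `t2Drift_of_rows`,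
whose `Zfree`, `mom`, `ρ` are PARAMETERS): with
`ZfreeSym X := (X jointly Lc-covariant) ∧ (∀ κ κ′ κ₁ κ₂, zmode Lc X κ κ′ (inl κ₁) (inl κ₂) + zmode Lc X κ′ κ (inl κ₁) (inl κ₂) = 0)` written inline, ANY first-moment
functional `mom` (unused — (R14-3) `mom := fun _ ↦ 0`), and `ρ := Lc⁻¹`: under the pin,
`∀ m k X C, 0 ≤ C → LocStencil₂ X C δin → ZfreeSym X → mom X ≤ C → LocStencil₂ (P m k X) (CT″·C·ρ^k) δT` for the transport of record `P`.  By
`zfreeSym_of_zfree` this implies the record-`Zfree` slot form `TransportIrrelevant.hTirr_three_slot` (p213474). -/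
theorem hTirr_three_symZ_slot (hLc : 1 ≤ Lc) (hK : UnitDecayK 3 Lc (sfStep Lc) (smStep 3 Lc) CK mK) (hmK : 0 < mK) (cE₂ : ℝ) {δin : ℝ}
    (hδin : 0 < δin) (mom : BiTab 3 → ℝ) :
    ∃ CT δT : ℝ, 0 ≤ CT ∧ 0 < δT ∧ δT ≤ δin ∧ (|cE₂| ≤ (Lc : ℝ) ^ (2 * (3 + 1)) →
      ∀ (m k : ℕ) (X : BiTab 3) (C : ℝ), 0 ≤ C → LocStencil₂ X C δin →
        ((∀ κ u κ' u' t, X κ (u + (Lc : ℤ) • t) κ' (u' + (Lc : ℤ) • t) = shiftK (-((Lc : ℤ) • t)) (X κ u κ' u')) ∧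
          (∀ κ κ' κ₁ κ₂, zmode Lc X κ κ' (Sum.inl κ₁) (Sum.inl κ₂) + zmode Lc X κ' κ (Sum.inl κ₁) (Sum.inl κ₂) = 0)) → mom X ≤ C →
        LocStencil₂ (transport (fun j => lin4 (cE₂ * (Lc : ℝ) ^ (2 * (3 + 1)))
          (unitK (sfStep Lc j) (smStep 3 Lc j) (KInvStep (d := 3) Lc j)) Lc) m k X) (CT * C * ((Lc : ℝ)⁻¹) ^ k) δT) := by
  obtain ⟨CT, δT, hCT, hδT, hδTin, h⟩ := hTirr_three_symZ hLc hK hmK cE₂ hδin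
  exact ⟨CT, δT, hCT, hδT, hδTin, fun hpin m k X C hC hX hZf _ => h hpin m k X C hC hX hZf.1 hZf.2⟩

/- CONSISTENCY CHECK BY NAME (an `example`, no declaration — the type below IS the type of `TransportIrrelevant.hTirr_three_slot` p213474, so a
`theorem` here would be a restatement): the record-`Zfree` slot form follows from the symmetrised one via `zfreeSym_of_zfree` — the
symmetrised row is the STRONGER row. -/
example (hLc : 1 ≤ Lc) (hK : UnitDecayK 3 Lc (sfStep Lc) (smStep 3 Lc) CK mK) (hmK : 0 < mK) (cE₂ : ℝ) {δin : ℝ}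
    (hδin : 0 < δin) (mom : BiTab 3 → ℝ) :
    ∃ CT δT : ℝ, 0 ≤ CT ∧ 0 < δT ∧ δT ≤ δin ∧ (|cE₂| ≤ (Lc : ℝ) ^ (2 * (3 + 1)) →
      ∀ (m k : ℕ) (X : BiTab 3) (C : ℝ), 0 ≤ C → LocStencil₂ X C δin →
        ((∀ κ u κ' u' t, X κ (u + (Lc : ℤ) • t) κ' (u' + (Lc : ℤ) • t) = shiftK (-((Lc : ℤ) • t)) (X κ u κ' u')) ∧
          (∀ κ κ' κ₁ κ₂, zmode Lc X κ κ' (Sum.inl κ₁) (Sum.inl κ₂) = 0)) → mom X ≤ C →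
        LocStencil₂ (transport (fun j => lin4 (cE₂ * (Lc : ℝ) ^ (2 * (3 + 1)))
          (unitK (sfStep Lc j) (smStep 3 Lc j) (KInvStep (d := 3) Lc j)) Lc) m k X) (CT * C * ((Lc : ℝ)⁻¹) ^ k) δT) := by
  obtain ⟨CT, δT, hCT, hδT, hδTin, h⟩ := hTirr_three_symZ_slot hLc hK hmK cE₂ hδin mom
  exact ⟨CT, δT, hCT, hδT, hδTin, fun hpin m k X C hC hX hZf hm => h hpin m k X C hC hX (zfreeSym_of_zfree hZf) hm⟩

end Three

end Summit.QuantumFields.BalabanUV.Beta.GAN24.TransportIrrelevantSym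

end
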